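import Literature.AlgebraicGeometry.Resolution.ExceptionalDivisorLocallyTrivialHolds
import HarnessLib

/-!
# Zariski-locally trivial projective bundles — the carrier predicate

`IsZariskiProjectiveBundle r q` for a morphism `q : E ⟶ X` of schemes over a field `k`: every point
of `X` has a Zariski-open neighbourhood `U` over which `q⁻¹ U → U` is isomorphic, over `U`, to
`U × ℙʳ_k → U`. This is VERBATIM the local-triviality clause of the tree's named fact
`Hartshorne1977_exceptionalDivisor_locallyTrivial` (Hartshorne II Thm. 8.24 (b): the exceptional divisor
of a smooth blow-up) and of `Summit.HodgeConjecture.….PullbackAlgebraicNormalCone.stub_bundleLerayHirsch`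
(Leray–Hirsch for such bundles), named once so that consumers (the exceptional divisor, the trivial
bundle `fst : X × ℙʳ → X`, projective-bundle closure rules for the Hodge conjecture) can cite it.

* `IsZariskiProjectiveBundle` — the predicate [cite: Hartshorne1977, II §7 (ℙ(ℰ), Prop. 7.11) and II Thm. 8.24 (b)];
* `isZariskiProjectiveBundle_exceptionalDivisor` — the exceptional divisor `B ×_V Z → Z` of a smooth
  blow-up is one (restates the PROVED fact `Hartshorne1977_exceptionalDivisor_locallyTrivial_holds`);
* `isZariskiProjectiveBundle_fst` — NON-VACUITY: the trivial bundle `fst : X ⊗ ℙʳ ⟶ X` is one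
  (via the private plumbing iso `topIsoOver : X|_⊤ ≅ X` over the base).

Origin: cell `hodge-nonav`, seat p1 g19 (ask A16; consumers: `Theorems/ProjectiveBundleHodgeConjecture`
(A12) and `Theorems/SmoothBlowupHodgeConjecture` (A15) of `Summits/HodgeConjecture`).
-/

noncomputable section

open CategoryTheory CategoryTheory.Limits AlgebraicGeometry MonoidalCategory CartesianMonoidalCategory
open Literature.AlgebraicGeometry.Motives

namespace Literature.AlgebraicGeometry.Resolution

universe u

variable {k : Type u} [Field k]

/-- **Zariski-locally trivial `ℙʳ`-bundle.** `q : E ⟶ X` (schemes over the field `k`) is a Zariski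
`ℙʳ`-bundle if every `x : X` has an open neighbourhood `U` and an isomorphism over `k`
`φ : q⁻¹ U ≅ U ⊗ ℙʳ_k` compatible with the projections to `U`
(`φ ≫ pr₁ ≫ (U ↪ X) = (q⁻¹ U ↪ E) ≫ q`). Verbatim the clause of
`Hartshorne1977_exceptionalDivisor_locallyTrivial`. [cite: Hartshorne1977, II §7 p. 162 (ℙ(ℰ) for ℰ
locally free, Prop. 7.11) and II Thm. 8.24 (b)] -/
def IsZariskiProjectiveBundle (r : ℕ) {X E : SchemeOver k} (q : E ⟶ X) : Prop :=
  ∀ x : X.left, ∃ U : X.left.Opens, x ∈ U ∧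
    ∃ φ : (Over.mk ((q.left ⁻¹ᵁ U).ι ≫ E.hom) : SchemeOver k) ≅
        (Over.mk (U.ι ≫ X.hom) : SchemeOver k) ⊗ projectiveSpace r k,
      φ.hom.left ≫ (fst (Over.mk (U.ι ≫ X.hom) : SchemeOver k) (projectiveSpace r k)).left ≫ U.ι =
        (q.left ⁻¹ᵁ U).ι ≫ q.left

/-- **The exceptional divisor of a smooth blow-up is a Zariski `ℙʳ`-bundle over the centre**: for smooth
projective `V`, `Z` of dimensions `m + r + 1`, `m`, a closed immersion `i : Z ⟶ V` and a blowing up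
`β : B ⟶ V` along `ker i`, the projection `E = B ×_V Z ⟶ Z` is a Zariski `ℙʳ`-bundle — the PROVED
named fact `Hartshorne1977_exceptionalDivisor_locallyTrivial_holds`, restated on the predicate.
[cite: Hartshorne1977, II Thm. 8.24 (b)] [cite: Liu2002, Thm. 8.1.19 (b)] -/
theorem isZariskiProjectiveBundle_exceptionalDivisor {m r : ℕ} {V Z B : SchemeOver k} (i : Z ⟶ V)
    (β : B ⟶ V) (hV : IsSmoothProjective (m + r + 1) V) (hZ : IsSmoothProjective m Z)
    (hi : IsClosedImmersion i.left) (hβ : IsBlowup β.left i.left.ker) :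
    IsZariskiProjectiveBundle r
      (Over.homMk (pullback.snd β.left i.left) rfl :
        (Over.mk (pullback.snd β.left i.left ≫ Z.hom) : SchemeOver k) ⟶ Z) :=
  Hartshorne1977_exceptionalDivisor_locallyTrivial_holds k i β hV hZ hi hβ

/-- Plumbing (private): the restriction of `X` to the open `⊤` is isomorphic to `X` over the base
(`Scheme.topIso` promoted to the `Over` category). [folklore] -/
private def topIsoOver (X : SchemeOver k) :
    (Over.mk ((⊤ : X.left.Opens).ι ≫ X.hom) : SchemeOver k) ≅ X :=
  Over.isoMk X.left.topIso rfl

/-- Plumbing (private): the underlying morphism of `topIsoOver X` is the open immersion `⊤ ↪ X`.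
[folklore] -/
@[simp] private theorem topIsoOver_hom_left (X : SchemeOver k) :
    (topIsoOver X).hom.left = (⊤ : X.left.Opens).ι := by
  simp [topIsoOver]

/-- Plumbing (private): the inverse of `topIsoOver X` followed by `⊤ ↪ X` is the identity.
[folklore] -/
@[simp] private theorem topIsoOver_inv_left_ι (X : SchemeOver k) :
    (topIsoOver X).inv.left ≫ (⊤ : X.left.Opens).ι = 𝟙 _ :=
  X.left.topIso.inv_hom_id

/-- **NON-VACUITY: the trivial bundle `fst : X ⊗ ℙʳ ⟶ X` is a Zariski `ℙʳ`-bundle** (one chart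
`U = ⊤`, `φ = (⊤ ≅ X ⊗ ℙʳ) ≪≫ ((⊤ ≅ X)⁻¹ ▷ ℙʳ)`). [cite: Hartshorne1977, II §7 p. 162] -/
theorem isZariskiProjectiveBundle_fst (X : SchemeOver k) (r : ℕ) :
    IsZariskiProjectiveBundle r (fst X (projectiveSpace r k)) := by
  intro x
  refine ⟨⊤, trivial, topIsoOver (X ⊗ projectiveSpace r k) ≪≫
    whiskerRightIso (topIsoOver X).symm (projectiveSpace r k), ?_⟩
  -- in the Over category: `φ ≫ fst ≫ eX.hom = eE.hom ≫ fst`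
  have hO : (topIsoOver (X ⊗ projectiveSpace r k) ≪≫
      whiskerRightIso (topIsoOver X).symm (projectiveSpace r k)).hom ≫
        fst (Over.mk ((⊤ : X.left.Opens).ι ≫ X.hom) : SchemeOver k) (projectiveSpace r k) ≫
          (topIsoOver X).hom =
      (topIsoOver (X ⊗ projectiveSpace r k)).hom ≫ fst X (projectiveSpace r k) := by
    simp only [Iso.trans_hom, whiskerRightIso_hom, Iso.symm_hom, Category.assoc]
    rw [whiskerRight_fst_assoc, Iso.inv_hom_id, Category.comp_id]
  have key := congrArg (fun f ↦ f.left) hO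
  simp only [Over.comp_left] at key
  exact key

end Literature.AlgebraicGeometry.Resolution

end
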